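import Summits.AnomalousDissipation.AnomalousDissipation.Theorems.SawtoothPulseCascadeK1LocalisedCascadeCascadeStepHSharp
import Summits.AnomalousDissipation.AnomalousDissipation.Theorems.SawtoothPulseCascadeK1LocalisedCascadeSymbolSocketH
import Summits.AnomalousDissipation.AnomalousDissipation.Theorems.SawtoothPulseCascadeK1LocalisedCascadeCutoffSocketH
import Summits.AnomalousDissipation.AnomalousDissipation.Theorems.SawtoothPulseCascadeK1LocalisedCascadeTwistMoments

/-!
# K1loc, line `Spectral` / SeqCone — helper: THE H HALF-SLOT OF THE LEDGER, CONCRETE (all sockets instantiated, `r = 1`)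

Helper file of the prover lane on the crux `K1LocalisedCascade` (stmt-AnomalousDissipation-19491), route
`SawtoothPulseCascade` (glue seat k1loc-p3; Stage 4 of the concrete instantiation of `…K1Ledger.cascade_ledger_step_H′`).
Every auxiliary object of the sharp capstone is INSTANTIATED: slope profile `Q = U_j′`, strip cut-offs `X^± ` at width
`ε`, slot cut-offs `X̃^±` at width `2ε` (`ε₁ = 4ε`, `C₁ = c₁ = 2C₁′(M+4)Λ_j`, `C₂ = c₂ = (4C₂′(M+4)²+2C₁′(2M²+33))Λ_j²`,
`Λ_j = 2πN_j/δ_j`, flat layer `e^{−M²/2} ≤ ε/2`), exact-flat profile `Ũ_j` at threshold `3ε` and residual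
`Q_res = −γ(U_j − Ũ_j)`, the PRODUCT symbols `μ̂_j = 1 − g^S_L·g^env_{R,w}` (old) and `m̂_j = 1 − g^M_{L/(1+ε_s)}·g^env_{R′,w′}`
(new) of `…SymbolPackageLattice`, shifts `b^±_n = round(±γn)` (`β₀ = ½`), envelope radius `R₀ = R + w`, first-order
moduli `(C/b)|q_v|` from the symbol socket (`…SymbolSocketH`, constants `C_S, C_M` passed as hypotheses so that they are
shared across phases), the four `ℓ¹` moments and the twist moments from `…SpectralMoments/…TwistMoments` with the `ε`-free
`D₂ = c₂`, and the two zone volumes `≤ 4Mδ_j/π` (`…CutoffSocketH`).  Result `cascade_ledger_step_H_concrete`: the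
energy-form inequality `Σ m̂²|𝓕θ(t₁)|² ≤ (√Σ μ̂²|𝓕θ(t₀)|² + Eᴴ_j‖θ₀‖)² + ζᴴ_j` with `Eᴴ_j, ζᴴ_j` EXPLICIT in
`(γ, N_j/δ_j, δ_j, ε, M, C₁′, C₂′, L, R, w, b, C_S, C_M, κ, B)`.  No definitions; no statement about the stub.
[cite: BedrossianCotiZelati2017, §2] [cite: Grafakos2014, Prop. 3.1.2 (5) and Prop. 3.2.7 (3)] [problem: turb]
-/

-- `Summit.<Summit>.<Problem>`: single-conjunct summit, the duplicate namespace segment is deliberate.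
set_option linter.dupNamespace false

noncomputable section

namespace Summit.AnomalousDissipation.AnomalousDissipation.Theorems.SawtoothPulseCascade.K1Ledger

open MeasureTheory Set Filter Topology UnitAddTorus Function Complex
open scoped ComplexConjugate ContDiff Nat
open Literature.Analysis Literature.Analysis.FunctionSpaces Literature.Analysis.FunctionSpaces.Torus
open Literature.Analysis.FluidPDE.ShearStage
open Literature.Analysis.FluidPDE.SawtoothCascade Literature.Analysis.FluidPDE.SawtoothCascade.CascadeParams
open Summit.AnomalousDissipation.AnomalousDissipation.Theorems.SawtoothPulseCascade.SpectralLeakage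
open Summit.AnomalousDissipation.AnomalousDissipation.Theorems.SawtoothPulseCascade.K1Slot
open Summit.AnomalousDissipation.AnomalousDissipation.Theorems.SawtoothPulseCascade.K1Cutoff
open Summit.AnomalousDissipation.AnomalousDissipation.Theorems.SawtoothPulseCascade.K1Symbol
open Summit.AnomalousDissipation.AnomalousDissipation.Theorems.SawtoothPulseCascade.K1Flat

/-! ## Two arithmetic steps of the final massaging -/

/-- `√(a² + b²) ≤ √2·c` for `0 ≤ a, b ≤ c`. [folklore] -/
theorem sqrt_sq_add_sq_le {a b c : ℝ} (ha : 0 ≤ a) (hb : 0 ≤ b) (hac : a ≤ c) (hbc : b ≤ c) :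
    Real.sqrt (a ^ 2 + b ^ 2) ≤ Real.sqrt 2 * c := by
  have hc : 0 ≤ c := ha.trans hac
  calc Real.sqrt (a ^ 2 + b ^ 2) ≤ Real.sqrt (2 * c ^ 2) := Real.sqrt_le_sqrt (by nlinarith)
    _ = Real.sqrt 2 * c := by rw [Real.sqrt_mul (by norm_num), Real.sqrt_sq hc]

/-- Monotonicity of the shape `(√S + X√E)² + 2T₂E + (B²V₁ + 2(T₂′E + √E(B/4)√V₂))` of the capstone's right-hand side in
`X, T₂, T₂′, V₁, V₂`. [folklore] -/
theorem ledger_rhs_mono {S E X X' T2p E2p B V1 Vz T2s E2s V2 : ℝ} (hX0 : 0 ≤ X) (hX : X ≤ X') (h2p : T2p ≤ E2p)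
    (hE : 0 ≤ E) (hV1 : V1 ≤ Vz) (h2s : T2s ≤ E2s) (hV2 : V2 ≤ Vz) (hB : 0 ≤ B) :
    (Real.sqrt S + X * Real.sqrt E) ^ 2 + 2 * (T2p * E) + (B ^ 2 * V1 + 2 * (T2s * E + Real.sqrt E * ((B / 4) * Real.sqrt V2)))
      ≤ (Real.sqrt S + X' * Real.sqrt E) ^ 2 + 2 * (E2p * E) +
        (B ^ 2 * Vz + 2 * (E2s * E + Real.sqrt E * ((B / 4) * Real.sqrt Vz))) := by
  refine add_le_add (add_le_add ?_ ?_) ?_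
  · exact pow_le_pow_left₀ (add_nonneg (Real.sqrt_nonneg _) (mul_nonneg hX0 (Real.sqrt_nonneg _)))
      (add_le_add le_rfl (mul_le_mul_of_nonneg_right hX (Real.sqrt_nonneg _))) 2
  · exact mul_le_mul_of_nonneg_left (mul_le_mul_of_nonneg_right h2p hE) (by norm_num)
  · refine add_le_add (mul_le_mul_of_nonneg_left hV1 (sq_nonneg B)) (mul_le_mul_of_nonneg_left (add_le_add
      (mul_le_mul_of_nonneg_right h2s hE) (mul_le_mul_of_nonneg_left (mul_le_mul_of_nonneg_left
      (Real.sqrt_le_sqrt hV2) (by positivity)) (Real.sqrt_nonneg _))) (by norm_num))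

/-- The binomial sum of the sharp Wiener weight at `r = 1`: `Σ_{i<3} C(2,i) βⁱ D_{2−i} = D₂ + 2βD₁ + β²D₀`. [folklore] -/
theorem sum_range_choose_two (D : ℕ → ℝ) (β : ℝ) :
    (∑ i ∈ Finset.range (1 + 1 + 1), ((1 + 1).choose i : ℝ) * β ^ i * D (1 + 1 - i)) =
      D 2 + 2 * β * D 1 + β ^ 2 * D 0 := by
  simp only [Finset.sum_range_succ, Finset.sum_range_zero]
  norm_num

section Cascade

variable (P : CascadeParams)

/-- **The H half-slot of the energy ledger for the cascade, CONCRETE.**  For the true classical cascade scalar `θ` with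
`|θ₀| ≤ B`, phase `j`, cut-off width `0 < ε ≤ 1/6` with `γ·4ε ≤ 1`, flat-layer parameter `M ≥ 1` with `e^{−M²/2} ≤ ε/2`,
`Mδ_j ≤ π/2`, symbol parameters with `a + ε_a + γ/(2L) ≤ a₂`, `(1+γ)(R+w) + ½ ≤ R′`, and the symbol socket at scale `b`
with constants `C_S, C_M` (`…SymbolSocketH`):
`Σ m̂_j(k)²|𝓕θ(t₁)(k)|² ≤ (√(Σ μ̂_j(k)²|𝓕θ(t₀)(k)|²) + Eᴴ·‖θ₀‖)² + 2e₂‖θ₀‖² + (B²V + 2(e₂′‖θ₀‖² + ‖θ₀‖(B/4)√V))` with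
`V = 4Mδ_j/π`, `e₂ = (C_M/b)c₂/(4π√3)`, `e₂′ = (C_M/b)(2c₂)/(4π√3)` and `Eᴴ` the displayed sum.
[cite: BedrossianCotiZelati2017, §2] [cite: Grafakos2014, Prop. 3.1.2 (5) and Prop. 3.2.7 (3)] -/
theorem cascade_ledger_step_H_concrete (hγ : 0 < P.γ) (hδ₀ : 0 < P.δ₀) (hd : 0 < P.d) (j : ℕ) (hN : P.N j ≠ 0)
    -- cut-off width and flat-layer parameter, smooth-step constants
    {ε M C₁ C₂ : ℝ} (hε : 0 < ε) (hε6 : ε ≤ 1 / 6) (hγε : P.γ * (2 * (2 * ε)) ≤ 1) (hM : 1 ≤ M)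
    (hMε : Real.exp (-(M ^ 2 / 2)) ≤ ε / 2) (hMδ : M * P.δ j ≤ Real.pi / 2)
    (hC₁ : ∀ x, |deriv Real.smoothTransition x| ≤ C₁) (hC₂ : ∀ x, |deriv (deriv Real.smoothTransition) x| ≤ C₂)
    {c₁ c₂ : ℝ} (hc₁ : c₁ = 2 * C₁ * (M + 4) * (2 * Real.pi * P.N j / P.δ j))
    (hc₂ : c₂ = (4 * C₂ * (M + 4) ^ 2 + 2 * C₁ * (2 * M ^ 2 + 33)) * (2 * Real.pi * P.N j / P.δ j) ^ 2)
    -- symbol parameters and the common fibre scale `b`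
    {εs εa a a₂ L R w R' w' b : ℝ} (hεs : 0 < εs) (hεa : 0 < εa) (hL : 0 < L) (hR : 0 < R) (hw : 0 < w)
    (hw' : 0 < w') (hb : 0 < b) (ha₂' : a + εa + P.γ / (2 * L) ≤ a₂) (hRR : (1 + P.γ) * (R + w) + 1 / 2 ≤ R')
    -- the symbol socket (first-order fibre data of `μ̂` and of the shifted squares of `m̂` at scale `b`: the bodies of
    -- `…K1Symbol.exists_fibre_data_symProdS_H` / `exists_fibre_data_symProdM_H_sq`, which need `bγ ≤ ε_aL/(1+ε_s)`,
    -- `b ≤ w`, `b ≤ w′`, `a, a₂ > 0`; passed as hypotheses so that the absolute constants are shared across phases)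
    {CS CM : ℝ} (hCS : 0 ≤ CS) (hCM : 0 ≤ CM)
    (hSockS : ∀ n : ℤ,
      ContDiff ℝ 1 (fun t : ℝ => 1 - Real.smoothTransition ((|(n : ℝ)| - L) / (εs * L)) *
          (1 - Real.smoothTransition ((P.γ * |t| - a * |(n : ℝ)|) / (εa * L))) *
          ((1 - Real.smoothTransition ((|(n : ℝ)| - R) / w)) * (1 - Real.smoothTransition ((|t| - R) / w)))) ∧
      (∀ t : ℝ, |1 - Real.smoothTransition ((|(n : ℝ)| - L) / (εs * L)) *
          (1 - Real.smoothTransition ((P.γ * |t| - a * |(n : ℝ)|) / (εa * L))) *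
          ((1 - Real.smoothTransition ((|(n : ℝ)| - R) / w)) * (1 - Real.smoothTransition ((|t| - R) / w)))| ≤ 1) ∧
      ∀ t : ℝ, |deriv (fun t : ℝ => 1 - Real.smoothTransition ((|(n : ℝ)| - L) / (εs * L)) *
          (1 - Real.smoothTransition ((P.γ * |t| - a * |(n : ℝ)|) / (εa * L))) *
          ((1 - Real.smoothTransition ((|(n : ℝ)| - R) / w)) * (1 - Real.smoothTransition ((|t| - R) / w)))) t| ≤ CS / b)
    (hSockM : ∀ (n : ℤ) (t₀ : ℝ),
      ContDiff ℝ 1 (fun t : ℝ => (1 - Real.smoothTransition ((|(n : ℝ)| - L / (1 + εs)) / (εs * (L / (1 + εs)))) *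
          (1 - Real.smoothTransition ((P.γ * |t - t₀ + P.γ * n| - a₂ * |(n : ℝ)|) / (εa * (L / (1 + εs)))) *
            Real.smoothTransition ((P.γ * |t - t₀ - P.γ * n| - a₂ * |(n : ℝ)|) / (εa * (L / (1 + εs))))) *
          ((1 - Real.smoothTransition ((|(n : ℝ)| - R') / w')) * (1 - Real.smoothTransition ((|t - t₀| - R') / w')))) ^ 2) ∧
      (∀ t : ℝ, |(1 - Real.smoothTransition ((|(n : ℝ)| - L / (1 + εs)) / (εs * (L / (1 + εs)))) *
          (1 - Real.smoothTransition ((P.γ * |t - t₀ + P.γ * n| - a₂ * |(n : ℝ)|) / (εa * (L / (1 + εs)))) *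
            Real.smoothTransition ((P.γ * |t - t₀ - P.γ * n| - a₂ * |(n : ℝ)|) / (εa * (L / (1 + εs))))) *
          ((1 - Real.smoothTransition ((|(n : ℝ)| - R') / w')) * (1 - Real.smoothTransition ((|t - t₀| - R') / w')))) ^ 2|
          ≤ 1) ∧
      ∀ t : ℝ, |deriv (fun t : ℝ => (1 - Real.smoothTransition ((|(n : ℝ)| - L / (1 + εs)) / (εs * (L / (1 + εs)))) *
          (1 - Real.smoothTransition ((P.γ * |t - t₀ + P.γ * n| - a₂ * |(n : ℝ)|) / (εa * (L / (1 + εs)))) *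
            Real.smoothTransition ((P.γ * |t - t₀ - P.γ * n| - a₂ * |(n : ℝ)|) / (εa * (L / (1 + εs))))) *
          ((1 - Real.smoothTransition ((|(n : ℝ)| - R') / w')) * (1 - Real.smoothTransition ((|t - t₀| - R') / w')))) ^ 2) t|
          ≤ CM / b)
    -- the viscosity, the scalar and its sup bound
    {κ : ℝ} (hκ : 0 ≤ κ) {θ : ℝ → UnitAddTorus (Fin 2) → ℝ}
    (hθ : FluidPDE.Torus.IsClassicalScalarTransportOn (Ico 0 1) κ P.field θ) {B : ℝ} (hB : ∀ x, |θ 0 x| ≤ B) :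
    ∑' k : Fin 2 → ℤ, (1 - Real.smoothTransition ((|(k 0 : ℝ)| - L / (1 + εs)) / (εs * (L / (1 + εs)))) *
          (1 - Real.smoothTransition ((P.γ * |(k 1 : ℝ) + P.γ * (k 0)| - a₂ * |(k 0 : ℝ)|) / (εa * (L / (1 + εs)))) *
            Real.smoothTransition ((P.γ * |(k 1 : ℝ) - P.γ * (k 0)| - a₂ * |(k 0 : ℝ)|) / (εa * (L / (1 + εs))))) *
          ((1 - Real.smoothTransition ((|(k 0 : ℝ)| - R') / w')) * (1 - Real.smoothTransition ((|(k 1 : ℝ)| - R') / w'))))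
          ^ 2 * ‖mFourierCoeff (fun x => (θ (tStart j + tHalf j) x : ℂ)) k‖ ^ 2 ≤
      (Real.sqrt (∑' k : Fin 2 → ℤ, (1 - Real.smoothTransition ((|(k 0 : ℝ)| - L) / (εs * L)) *
            (1 - Real.smoothTransition ((P.γ * |(k 1 : ℝ)| - a * |(k 0 : ℝ)|) / (εa * L))) *
            ((1 - Real.smoothTransition ((|(k 0 : ℝ)| - R) / w)) * (1 - Real.smoothTransition ((|(k 1 : ℝ)| - R) / w))))
            ^ 2 * ‖mFourierCoeff (fun x => (θ (tStart j) x : ℂ)) k‖ ^ 2) +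
          (Real.sqrt 2 * (CS / b * (c₂ / (4 * Real.pi * Real.sqrt 3))) +
            Real.sqrt 2 * (2 * κ * tHalf j * c₂ + 4 * c₁ * Real.sqrt (κ * tHalf j / 2) +
                Real.sqrt (P.γ * (2 * (2 * ε)) * (5 + 6 * c₁ ^ 2 * κ * tHalf j)) +
                CS / b * ((c₂ + 2 * Real.pi * c₁ + Real.pi ^ 2) / (2 * Real.sqrt 3 * (2 * Real.pi))) +
                CS / b * ((2 * Real.pi * (R + w) *
                    (P.γ * ((2 + 8 * C₁) * (M + 4) * (2 * Real.pi * P.N j / P.δ j) * (3 * ε))) +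
                  (2 * Real.pi * (R + w) * (P.γ * (2 * (3 * ε)))) ^ 2) / (4 * Real.pi * Real.sqrt 3)) +
              Real.sqrt (2 * (CM / b * ((c₂ + 2 * Real.pi * c₁ + Real.pi ^ 2) / (2 * Real.sqrt 3 * (2 * Real.pi))))))) *
            Real.sqrt (FluidPDE.Torus.scalarL2Sq (θ 0))) ^ 2 +
        2 * (CM / b * (c₂ / (4 * Real.pi * Real.sqrt 3)) * FluidPDE.Torus.scalarL2Sq (θ 0)) +
        (B ^ 2 * (4 * M * P.δ j / Real.pi) +
          2 * (CM / b * ((c₂ + c₂) / (4 * Real.pi * Real.sqrt 3)) * FluidPDE.Torus.scalarL2Sq (θ 0) +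
            Real.sqrt (FluidPDE.Torus.scalarL2Sq (θ 0)) * ((B / 4) * Real.sqrt (4 * M * P.δ j / Real.pi)))) := by
  -- elementary facts
  have hδj : 0 < P.δ j := P.δ_pos hδ₀ hd j
  have hγ0 : 0 ≤ P.γ := hγ.le
  have h2ε : 0 < 2 * ε := by positivity
  have hε2' : ε ≤ 1 / 2 := by linarith
  have h2ε2 : 2 * ε ≤ 1 / 2 := by linarith
  have hε' : ε ≤ 2 / 9 := by linarith
  have hexp0 : 0 < Real.exp (-(M ^ 2 / 2)) := Real.exp_pos _
  have hMε1 : Real.exp (-(M ^ 2 / 2)) ≤ 2 * ε := by linarith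
  have hMε2 : Real.exp (-(M ^ 2 / 2)) ≤ 2 * (2 * ε) := by linarith
  have hMε3 : Real.exp (-(M ^ 2 / 2)) ≤ 2 * (3 * ε) := by linarith
  have hMε0 : 2 * Real.exp (-(M ^ 2 / 2)) ≤ ε := by linarith
  have hC₁0 : 0 ≤ C₁ := (abs_nonneg _).trans (hC₁ 0)
  have hC₂0 : 0 ≤ C₂ := (abs_nonneg _).trans (hC₂ 0)
  have hΛ0 : 0 ≤ 2 * Real.pi * P.N j / P.δ j := by positivity
  have hc₁0 : 0 ≤ c₁ := by rw [hc₁]; positivity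
  have hc₂0 : 0 ≤ c₂ := by rw [hc₂]; positivity
  have htH : 0 < tHalf j := tHalf_pos j
  have hE0 : 0 ≤ FluidPDE.Torus.scalarL2Sq (θ 0) := FluidPDE.Torus.scalarL2Sq_nonneg _
  have hB0 : 0 ≤ B := (abs_nonneg _).trans (hB 0)
  have hCSb : 0 ≤ CS / b := div_nonneg hCS hb.le
  have hCMb : 0 ≤ CM / b := div_nonneg hCM hb.le
  have hU' : ContDiff ℝ ∞ (deriv (P.U j)) := P.contDiff_deriv_U hδj
  have hU'per : Function.Periodic (deriv (P.U j)) 1 := P.deriv_U_periodic j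
  have hnU' : ContDiff ℝ ∞ (fun y => -deriv (P.U j) y) := hU'.neg
  have hnU'per : Function.Periodic (fun y => -deriv (P.U j) y) 1 := fun y => by simp only [hU'per y]
  -- the profiles
  set Q : ShearProfile := ⟨deriv (P.U j), hU'per, hU'⟩ with hQ_def
  set Xsp : ShearProfile := ⟨fun y => Real.smoothTransition ((deriv (P.U j) y - (1 - 2 * (2 * ε))) / (2 * ε)),
    periodic_cutoff hU'per (2 * ε), contDiff_cutoff hU' (2 * ε)⟩ with hXsp_def
  set Xspd : ShearProfile := ⟨deriv fun y => Real.smoothTransition ((deriv (P.U j) y - (1 - 2 * (2 * ε))) / (2 * ε)),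
    periodic_deriv_cutoff hU'per (2 * ε), contDiff_deriv_cutoff hU' (2 * ε)⟩ with hXspd_def
  set Xp : ShearProfile := ⟨fun y => Real.smoothTransition ((deriv (P.U j) y - (1 - 2 * ε)) / ε),
    periodic_cutoff hU'per ε, contDiff_cutoff hU' ε⟩ with hXp_def
  set Xsm : ShearProfile := ⟨fun y => Real.smoothTransition ((-deriv (P.U j) y - (1 - 2 * (2 * ε))) / (2 * ε)),
    periodic_cutoff hnU'per (2 * ε), contDiff_cutoff hnU' (2 * ε)⟩ with hXsm_def
  set Xsmd : ShearProfile := ⟨deriv fun y => Real.smoothTransition ((-deriv (P.U j) y - (1 - 2 * (2 * ε))) / (2 * ε)),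
    periodic_deriv_cutoff hnU'per (2 * ε), contDiff_deriv_cutoff hnU' (2 * ε)⟩ with hXsmd_def
  set Xm : ShearProfile := ⟨fun y => Real.smoothTransition ((-deriv (P.U j) y - (1 - 2 * ε)) / ε),
    periodic_cutoff hnU'per ε, contDiff_cutoff hnU' ε⟩ with hXm_def
  set Z : ShearProfile := ⟨fun _ => 0, fun _ => rfl, contDiff_const⟩ with hZ_def
  set Ut : ShearProfile := ⟨fun y => P.U j y + ∫ t in (0 : ℝ)..y, ((1 - deriv (P.U j) t) *
        Real.smoothTransition ((deriv (P.U j) t - (1 - 2 * (3 * ε))) / (3 * ε)) +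
      (-1 - deriv (P.U j) t) * Real.smoothTransition ((-deriv (P.U j) t - (1 - 2 * (3 * ε))) / (3 * ε))),
    periodic_affinizeU P hδj hN (3 * ε), contDiff_affinizeU P hδj hN (3 * ε)⟩ with hUt_def
  have hIper := periodic_residual P hδj hN (3 * ε)
  set Qres : ShearProfile := ⟨fun y => -P.γ * ∫ t in (0 : ℝ)..y, ((1 - deriv (P.U j) t) *
        Real.smoothTransition ((deriv (P.U j) t - (1 - 2 * (3 * ε))) / (3 * ε)) +
      (-1 - deriv (P.U j) t) * Real.smoothTransition ((-deriv (P.U j) t - (1 - 2 * (3 * ε))) / (3 * ε))),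
    fun y => congrArg (fun z => -P.γ * z) (hIper y), contDiff_const.mul (contDiff_residual P hδj (3 * ε))⟩
    with hQres_def
  -- the symbols
  set μ : (Fin 2 → ℤ) → ℝ := fun k => 1 - Real.smoothTransition ((|(k 0 : ℝ)| - L) / (εs * L)) *
      (1 - Real.smoothTransition ((P.γ * |(k 1 : ℝ)| - a * |(k 0 : ℝ)|) / (εa * L))) *
      ((1 - Real.smoothTransition ((|(k 0 : ℝ)| - R) / w)) * (1 - Real.smoothTransition ((|(k 1 : ℝ)| - R) / w)))
    with hμ_def
  set m : (Fin 2 → ℤ) → ℝ := fun k => (1 - Real.smoothTransition ((|(k 0 : ℝ)| - L / (1 + εs)) / (εs * (L / (1 + εs)))) *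
      (1 - Real.smoothTransition ((P.γ * |(k 1 : ℝ) + P.γ * (k 0)| - a₂ * |(k 0 : ℝ)|) / (εa * (L / (1 + εs)))) *
        Real.smoothTransition ((P.γ * |(k 1 : ℝ) - P.γ * (k 0)| - a₂ * |(k 0 : ℝ)|) / (εa * (L / (1 + εs))))) *
      ((1 - Real.smoothTransition ((|(k 0 : ℝ)| - R') / w')) * (1 - Real.smoothTransition ((|(k 1 : ℝ)| - R') / w'))))
    with hm_def
  have hμ1 : ∀ k, |μ k| ≤ 1 := fun k => abs_symProdS_le_one P.γ εs εa a L R w (k 0) (k 1)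
  have hm1 : ∀ k, |m k| ≤ 1 := fun k => abs_symProdM_le_one P.γ εs εa a₂ (L / (1 + εs)) R' w' (k 0) (k 1)
  have hm21 : ∀ k, |m k ^ 2| ≤ 1 := fun k => by rw [abs_pow]; exact pow_le_one₀ (abs_nonneg _) (hm1 k)
  -- the first-order lattice moduli from the fibre data
  have hLipS : ∀ k q : Fin 2 → ℤ, (∀ l, l ≠ (1 : Fin 2) → q l = 0) → |μ k - μ (k - q)| ≤ CS / b * |(q 1 : ℝ)| := by
    intro k q hq
    refine abs_sub_le_of_fibre_deriv (μ := μ) (1 : Fin 2)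
      (Mf := fun k t => 1 - Real.smoothTransition ((|(k 0 : ℝ)| - L) / (εs * L)) *
        (1 - Real.smoothTransition ((P.γ * |t| - a * |(k 0 : ℝ)|) / (εa * L))) *
        ((1 - Real.smoothTransition ((|(k 0 : ℝ)| - R) / w)) * (1 - Real.smoothTransition ((|t| - R) / w))))
      (fun k => (hSockS (k 0)).1.differentiable (by simp)) (fun k t => (hSockS (k 0)).2.2 t) ?_ k q hq
    intro k q hq
    obtain ⟨h0, h1⟩ := sub_apply_of_axis k q hq
    simp only [hμ_def, h0, h1]
  obtain ⟨hω0, hω⟩ := modulus_of_fibre_lipschitz (μ := μ) (1 : Fin 2) (M₀ := 1) hCSb hμ1 hLipS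
  have hLipM : ∀ k q : Fin 2 → ℤ, (∀ l, l ≠ (1 : Fin 2) → q l = 0) →
      |m k ^ 2 - m (k - q) ^ 2| ≤ CM / b * |(q 1 : ℝ)| := by
    intro k q hq
    refine abs_sub_le_of_fibre_deriv (μ := fun k => m k ^ 2) (1 : Fin 2)
      (Mf := fun k t => (1 - Real.smoothTransition ((|(k 0 : ℝ)| - L / (1 + εs)) / (εs * (L / (1 + εs)))) *
          (1 - Real.smoothTransition ((P.γ * |t - 0 + P.γ * (k 0)| - a₂ * |(k 0 : ℝ)|) / (εa * (L / (1 + εs)))) *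
            Real.smoothTransition ((P.γ * |t - 0 - P.γ * (k 0)| - a₂ * |(k 0 : ℝ)|) / (εa * (L / (1 + εs))))) *
          ((1 - Real.smoothTransition ((|(k 0 : ℝ)| - R') / w')) *
            (1 - Real.smoothTransition ((|t - 0| - R') / w')))) ^ 2)
      (fun k => (hSockM (k 0) 0).1.differentiable (by simp)) (fun k t => (hSockM (k 0) 0).2.2 t) ?_ k q hq
    intro k q hq
    obtain ⟨h0, h1⟩ := sub_apply_of_axis k q hq
    simp only [hm_def, h0, h1, sub_zero]
  obtain ⟨hω20, hω2⟩ := modulus_of_fibre_lipschitz (μ := fun k => m k ^ 2) (1 : Fin 2) (M₀ := 1) hCMb hm21 hLipM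
  -- profile data of the cut-offs
  obtain ⟨D, hD0, hD1, hD2, hDp, hDm⟩ := exists_common_bound_seq_cutoff P hδj hε hM hMε1 hC₁ hC₂
  obtain ⟨Ds, -, -, hDs2, hDsp, hDsm⟩ := exists_common_bound_seq_cutoff P hδj h2ε hM hMε2 hC₁ hC₂
  have hD1' : D 1 = c₁ := hD1.trans hc₁.symm
  have hD2' : D 2 = c₂ := hD2.trans hc₂.symm
  have hD2sp : ∀ y, |iteratedDeriv 2 Xsp y| ≤ c₂ := fun y => by rw [hc₂, ← hDs2]; exact hDsp 2 y
  have hD2sm : ∀ y, |iteratedDeriv 2 Xsm y| ≤ c₂ := fun y => by rw [hc₂, ← hDs2]; exact hDsm 2 y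
  have hD2p : ∀ y, |iteratedDeriv 2 Xp y| ≤ c₂ := fun y => by rw [← hD2']; exact hDp 2 y
  have hD2m : ∀ y, |iteratedDeriv 2 Xm y| ≤ c₂ := fun y => by rw [← hD2']; exact hDm 2 y
  set XS : ShearProfile := ⟨fun y => Xp y + Xm y, fun y => by simp only [Xp.periodic y, Xm.periodic y],
    Xp.contDiff.add Xm.contDiff⟩ with hXS_def
  have hD2S : ∀ y, |iteratedDeriv 2 XS y| ≤ c₂ + c₂ := fun y => by
    have h : iteratedDeriv 2 (⇑XS) y = iteratedDeriv 2 Xp y + iteratedDeriv 2 Xm y := by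
      have hXS : (⇑XS : ℝ → ℝ) = ⇑Xp + ⇑Xm := rfl
      rw [hXS]
      exact iteratedDeriv_add (contDiff_infty.1 Xp.contDiff 2).contDiffAt
        (contDiff_infty.1 Xm.contDiff 2).contDiffAt
    rw [h]; exact (abs_add_le _ _).trans (add_le_add (hD2p y) (hD2m y))
  have hfunS : (fun x : UnitAddTorus (Fin 2) => ((Xp.onCircle (x 1) + Xm.onCircle (x 1) : ℝ) : ℂ)) =
      fun x => ((XS.onCircle (x 1) : ℝ) : ℂ) := by
    funext x; rw [onCircle_add]
  -- the four moments
  have hMsp := tsum_modulus_mul_norm_mFourierCoeff_onCircle_le Xsp (1 : Fin 2) (M₀ := (1 : ℝ)) hCSb hD2sp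
  have hMsm := tsum_modulus_mul_norm_mFourierCoeff_onCircle_le Xsm (1 : Fin 2) (M₀ := (1 : ℝ)) hCSb hD2sm
  have hM2p := tsum_modulus_mul_norm_mFourierCoeff_onCircle_le Xp (1 : Fin 2) (M₀ := (1 : ℝ)) hCMb hD2p
  have hM2S := tsum_modulus_mul_norm_mFourierCoeff_onCircle_le XS (1 : Fin 2) (M₀ := (1 : ℝ)) hCMb hD2S
  -- the residual
  have hDQ1 : ∀ y, |deriv Qres y| ≤ P.γ * (2 * (3 * ε)) := fun y => abs_deriv_residualShear_le P hγ0 hε hε6 hδj y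
  have hDQ2 : ∀ y, |deriv (deriv Qres) y| ≤
      P.γ * ((2 + 8 * C₁) * (M + 4) * (2 * Real.pi * P.N j / P.δ j) * (3 * ε)) :=
    fun y => abs_deriv_deriv_residualShear_le P hγ0 hε hε6 hM hMε3 hC₁ hδj hN y
  have hDQ10 : 0 ≤ P.γ * (2 * (3 * ε)) := by positivity
  have hDQ20 : 0 ≤ P.γ * ((2 + 8 * C₁) * (M + 4) * (2 * Real.pi * P.N j / P.δ j) * (3 * ε)) := by positivity
  -- the zone volumes
  obtain ⟨hV1, hV2⟩ := volume_real_cutoff_zones_le P hδj hN hM hMδ hMε0 hε hε2' Xp Xm (fun _ => rfl)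
    (fun _ => rfl) (1 : Fin 2)
  have hC1p : ∀ y, |Xspd y| ≤ c₁ := fun y => by
    rw [hc₁]; exact abs_deriv_cutoff_deriv_U_le_of_layer P hδj h2ε hM hMε2 hC₁ y
  have hC1m : ∀ y, |Xsmd y| ≤ c₁ := fun y => by
    rw [hc₁]; exact abs_deriv_cutoff_neg_deriv_U_le_of_layer P hδj h2ε hM hMε2 hC₁ y
  have hC2p : ∀ y, |deriv Xspd y| ≤ c₂ := fun y => by
    rw [hc₂]; exact abs_deriv_deriv_cutoff_deriv_U_le_of_layer P hδj h2ε hM hMε2 hC₁ hC₂ y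
  have hC2m : ∀ y, |deriv Xsmd y| ≤ c₂ := fun y => by
    rw [hc₂]; exact abs_deriv_deriv_cutoff_neg_deriv_U_le_of_layer P hδj h2ε hM hMε2 hC₁ hC₂ y
  -- THE CAPSTONE
  have hcap := cascade_ledger_step_H' P hγ0 hδ₀ hd j hN Q (fun _ => rfl) Xsp Xspd Xp Xsm Xsmd Xm Z (fun _ => rfl)
    (fun _ => rfl) hκ (by positivity : (0 : ℝ) ≤ 2 * (2 * ε)) hγε
    (fun y => abs_cutoff_le_one _ _ _) (fun y => abs_cutoff_le_one _ _ _)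
    (fun y => cutoff_sq_add_cutoff_neg_sq_le_one (V := deriv (P.U j)) h2ε h2ε2 y)
    hC1p hC1m hC2p hC2m
    (fun y hy => abs_deriv_U_sub_one_le_of_ne_zero P hδj h2ε hy)
    (fun y hy => abs_deriv_U_sub_neg_one_le_of_ne_zero P hδj h2ε hy)
    (fun y => cutoff_mul_cutoff_two_mul (V := deriv (P.U j)) hε y)
    (fun y => cutoff_mul_cutoff_two_mul (V := fun y => -deriv (P.U j) y) hε y)
    (fun _ => rfl) hε hε' (fun _ => rfl) (fun _ => rfl) Ut Qres (fun _ => rfl)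
    (fun y => by show P.γ * P.U j y = P.γ * (P.U j y + _) + (-P.γ * _); ring)
    hθ hB hμ1 hm1 hω0 hω hω20 hω2 hMsp.1 hMsm.1 hM2p.1 (by rw [hfunS]; exact hM2S.1) hDp hDm (r := 1) le_rfl
    (R + w)
    (fun n hn k hk => symProd_eq_one_of_le_abs hw (fun kh kv : ℤ =>
      Real.smoothTransition ((|(kh : ℝ)| - L) / (εs * L)) *
        (1 - Real.smoothTransition ((P.γ * |(kv : ℝ)| - a * |(kh : ℝ)|) / (εa * L)))) hn (k 0) (k 1) hk)
    (fun n => round (P.γ * n)) (fun n => round (-(P.γ * n))) (β₀ := 1 / 2) (by norm_num)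
    (fun n _ => abs_round_sub_le_pos P.γ n) (fun n _ => abs_round_sub_le_neg P.γ n)
    (fun n t => 1 - Real.smoothTransition ((|(n : ℝ)| - L) / (εs * L)) *
        (1 - Real.smoothTransition ((P.γ * |t| - a * |(n : ℝ)|) / (εa * L))) *
        ((1 - Real.smoothTransition ((|(n : ℝ)| - R) / w)) * (1 - Real.smoothTransition ((|t| - R) / w))))
    (fun n _ => (hSockS n).1) (fun n _ k hk => by subst hk; rfl)
    (Cμ := fun α => (CS / b) ^ α) (fun α => pow_nonneg hCSb α)
    (fun n _ α hα t => by
      interval_cases α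
      · rw [iteratedDeriv_zero, pow_zero]; exact (hSockS n).2.1 t
      · rw [iteratedDeriv_one, pow_one]; exact (hSockS n).2.2 t)
    (fun n k => (1 - Real.smoothTransition ((|(n : ℝ)| - L / (1 + εs)) / (εs * (L / (1 + εs)))) *
      (1 - Real.smoothTransition ((P.γ * |(k 1 : ℝ) + P.γ * n| - a₂ * |(n : ℝ)|) / (εa * (L / (1 + εs)))) *
        Real.smoothTransition ((P.γ * |(k 1 : ℝ) - P.γ * n| - a₂ * |(n : ℝ)|) / (εa * (L / (1 + εs))))) *
      ((1 - Real.smoothTransition ((|(n : ℝ)| - R') / w')) * (1 - Real.smoothTransition ((|(k 1 : ℝ)| - R') / w')))))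
    (fun n k hk => by subst hk; rfl)
    (fun n k => abs_symProdM_le_one P.γ εs εa a₂ (L / (1 + εs)) R' w' n (k 1))
    (fun n t => (1 - Real.smoothTransition ((|(n : ℝ)| - L / (1 + εs)) / (εs * (L / (1 + εs)))) *
          (1 - Real.smoothTransition ((P.γ * |t - ((round (P.γ * n) : ℤ) : ℝ) + P.γ * n| - a₂ * |(n : ℝ)|) /
              (εa * (L / (1 + εs)))) *
            Real.smoothTransition ((P.γ * |t - ((round (P.γ * n) : ℤ) : ℝ) - P.γ * n| - a₂ * |(n : ℝ)|) /
              (εa * (L / (1 + εs))))) *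
          ((1 - Real.smoothTransition ((|(n : ℝ)| - R') / w')) *
            (1 - Real.smoothTransition ((|t - ((round (P.γ * n) : ℤ) : ℝ)| - R') / w')))) ^ 2)
    (fun n t => (1 - Real.smoothTransition ((|(n : ℝ)| - L / (1 + εs)) / (εs * (L / (1 + εs)))) *
          (1 - Real.smoothTransition ((P.γ * |t - ((round (-(P.γ * n)) : ℤ) : ℝ) + P.γ * n| - a₂ * |(n : ℝ)|) /
              (εa * (L / (1 + εs)))) *
            Real.smoothTransition ((P.γ * |t - ((round (-(P.γ * n)) : ℤ) : ℝ) - P.γ * n| - a₂ * |(n : ℝ)|) /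
              (εa * (L / (1 + εs))))) *
          ((1 - Real.smoothTransition ((|(n : ℝ)| - R') / w')) *
            (1 - Real.smoothTransition ((|t - ((round (-(P.γ * n)) : ℤ) : ℝ)| - R') / w')))) ^ 2)
    (fun n _ => (hSockM n _).1) (fun n _ => (hSockM n _).1)
    (fun n _ k => symProdM_sub_single_sq_eq P.γ εs εa a₂ (L / (1 + εs)) R' w' n (round (P.γ * n)) k)
    (fun n _ k => symProdM_sub_single_sq_eq P.γ εs εa a₂ (L / (1 + εs)) R' w' n (round (-(P.γ * n))) k)
    (CN := fun α => (CM / b) ^ α) (fun α => pow_nonneg hCMb α)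
    (fun n _ α hα t => by
      interval_cases α
      · rw [iteratedDeriv_zero, pow_zero]; exact (hSockM n _).2.1 t
      · rw [iteratedDeriv_one, pow_one]; exact (hSockM n _).2.2 t)
    (fun n _ α hα t => by
      interval_cases α
      · rw [iteratedDeriv_zero, pow_zero]; exact (hSockM n _).2.1 t
      · rw [iteratedDeriv_one, pow_one]; exact (hSockM n _).2.2 t)
    (fun n _ k hk => by
      obtain ⟨e0, e1⟩ := sub_single_one_apply k (round (P.γ * n))
      have h := compat_symProd_H (a := a) (R := R) (w := w) (R' := R') (w' := w') hγ0 hεs hεa hL hw hw' ha₂' hRR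
        (σ := 1) (Or.inl rfl) n (k 0) (k 1) hk
      simp only [one_mul] at h
      simp only [hm_def, hμ_def, e0, e1]
      exact h)
    (fun n _ k hk => by
      obtain ⟨e0, e1⟩ := sub_single_one_apply k (round (-(P.γ * n)))
      have h := compat_symProd_H (a := a) (R := R) (w := w) (R' := R') (w' := w') hγ0 hεs hεa hL hw hw' ha₂' hRR
        (σ := -1) (Or.inr rfl) n (k 0) (k 1) hk
      simp only [neg_mul, one_mul] at h
      simp only [hm_def, hμ_def, e0, e1]
      exact h)
    (AQ := CS / b * ((2 * Real.pi * (R + w) *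
        (P.γ * ((2 + 8 * C₁) * (M + 4) * (2 * Real.pi * P.N j / P.δ j) * (3 * ε))) +
      (2 * Real.pi * (R + w) * (P.γ * (2 * (3 * ε)))) ^ 2) / (4 * Real.pi * Real.sqrt 3)))
    (by positivity)
    (fun n _ => (tsum_abs_mul_norm_mFourierCoeff_twist_le Qres n (1 : Fin 2) hDQ1 hDQ2).1)
    (fun n _ => (tsum_modulus_mul_norm_mFourierCoeff_twist_le Qres n (1 : Fin 2) (M₀ := (1 : ℝ)) hCSb hDQ1 hDQ2).1)
    (fun n hn => (tsum_modulus_mul_norm_mFourierCoeff_twist_le Qres n (1 : Fin 2) (M₀ := (1 : ℝ)) hCSb hDQ1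
      hDQ2).2.trans (twistMomentBound_mono hCSb hDQ10 hDQ20 hn))
  -- the final massaging
  refine hcap.trans ?_
  simp only [one_pow, one_mul]
  refine ledger_rhs_mono (add_nonneg (Real.sqrt_nonneg _) (Real.sqrt_nonneg _)) ?_ hM2p.2 hE0 hV1
    (by rw [hfunS]; exact hM2S.2) hV2 hB0
  refine add_le_add (sqrt_sq_add_sq_le (tsum_nonneg fun q => mul_nonneg (hω0 q) (norm_nonneg _))
    (tsum_nonneg fun q => mul_nonneg (hω0 q) (norm_nonneg _)) hMsp.2 hMsm.2) ?_
  have key : ∀ {u v : ℝ}, u = v → 0 ≤ v → Real.sqrt (u ^ 2 + u ^ 2) ≤ Real.sqrt 2 * v := by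
    intro u v huv hv
    subst huv
    exact sqrt_sq_add_sq_le hv hv le_rfl le_rfl
  have hM0 : 0 < M := by linarith
  have hRw : 0 < R + w := by positivity
  set tH : ℝ := tHalf j with htH_def
  have hv : 0 ≤ 2 * κ * tH * c₂ + 4 * c₁ * Real.sqrt (κ * tH / 2) +
      Real.sqrt (P.γ * (2 * (2 * ε)) * (5 + 6 * c₁ ^ 2 * κ * tH)) +
      CS / b * ((c₂ + 2 * Real.pi * c₁ + Real.pi ^ 2) / (2 * Real.sqrt 3 * (2 * Real.pi))) +
      CS / b * ((2 * Real.pi * (R + w) *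
          (P.γ * ((2 + 8 * C₁) * (M + 4) * (2 * Real.pi * P.N j / P.δ j) * (3 * ε))) +
        (2 * Real.pi * (R + w) * (P.γ * (2 * (3 * ε)))) ^ 2) / (4 * Real.pi * Real.sqrt 3)) +
      Real.sqrt (2 * (CM / b * ((c₂ + 2 * Real.pi * c₁ + Real.pi ^ 2) / (2 * Real.sqrt 3 * (2 * Real.pi))))) := by
    positivity
  refine key ?_ hv
  rw [Finset.Ico_self, Finset.sum_empty, sum_range_choose_two, hD0, hD1', hD2']
  have hπ : 2 * Real.pi * (1 / 2) = Real.pi := by ring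
  simp only [Nat.factorial_one, Nat.cast_one, div_one, pow_one, zero_add, mul_one, hπ]
  ring

end Cascade

end Summit.AnomalousDissipation.AnomalousDissipation.Theorems.SawtoothPulseCascade.K1Ledger
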